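/-
Copyright: the b2b-balaban T⁴-continuum CRUX team, row NE7b leaf lineage `t4-ne7b-formalise-leaf-02` (gen 136). Project licence.
-/
import Summits.QuantumFields.BalabanUV.T4Continuum.Spine.NE7b.LocalFloorTorusIMS
import Summits.QuantumFields.BalabanUV.T4Continuum.Spine.NE7b.FlatFullFormFloorTorusOp
import Mathlib.Analysis.CStarAlgebra.Matrix

/-!
# THE (h2) IMS FLOOR AT k = 1, U ≠ 1 FOR `M_m(ℂ)`-VALUED BOND FIELDS IN PRINT's OPERATOR CURRENCY ([B7] (19): the L²-operator norm of `M_m(ℂ) = L(ℂᵐ)`,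
# Mathlib scope `Matrix.Norms.L2Operator`, the cell's `UnitaryModel` convention): `…LocalFloorTorusIMS` §2 at `𝔸 := M_m(ℂ)` with its flat-floor letter
# `hflat` DISCHARGED by `…FlatFullFormFloorTorusOp` §2 ([B6] Lemma 2.4 PROVED, price `|m|`: `c = 1∕(12d²)·n^{−(d+1)}∕|m|`) — displayed now ONLY the local
# gauges with their `τ`-smallness on the terms meeting each sine-tent cube, `good ⊆` tree gauge, and the background data (`w`, `V₀ ∈ U1`)
# (row NE7b, node U5c; residual (R2′) family (2), letter (ℓ1); E-side capstone in ONE currency — the currency question Q-leaf05-g157-1 is not ruled, it is instantiated)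

Cell `pub-balaban`, sub-cell `t4`, spine estimate NE7b (`T4WeightBudget.RelWeightBound`; the cell's OWN estimate — NOT PRINTED in [Bałaban 1983–89],
NOT PROVED).  Crux-route work under `Spine/NE7b/` by a row leaf (`t4-ne7b-formalise-leaf-02`, E-side ∕ key-readings ∕ lattice-geometry lineage, gen 136)
under FREEZE (0)'s crux-prover clause; [folklore] junctions BY NAME; NOTHING of Bałaban's is asserted; no `def` (Mathlib's scoped L²-operator-norm instances
activated by `open scoped Matrix.Norms.L2Operator`, exactly as `Literature.….UnitaryModel` does); zero `sorry`; no `T4Continuum/Support` leaf.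
Imports: this lineage's `…LocalFloorTorusIMS` (LFTI `ims_floor_full_form_printed_weighted_sq_of_local_gauges`) and `…FlatFullFormFloorTorusOp` (FFFTO
`flat_full_form_floor_torus_op` — FFFT through leaf-05's AFFC §4, [B7] (20) `‖X‖ ≤ |X| ≤ √N‖X‖` PROVED), `Mathlib.Analysis.CStarAlgebra.Matrix`
(`Matrix.instL2OpNormedRing` ∕ `…NormedAlgebra` ∕ `CStarRing`, `Matrix.cstar_norm_def : ‖A‖ = ‖toEuclideanCLM A‖` by `rfl`).

WHY.  LFTI left three displayed letters under the U ≠ 1 (h2) floor: the flat floor `hflat` IN THE TERMS' CURRENCY, the local gauges, `good`.  In the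
Hilbert–Schmidt currency `hflat` is FFFT verbatim, but CTL ∕ ATL ∕ FFSQ run with `‖1‖ = 1` (`NormOneClass`), false for `M_m(ℂ)`'s HS norm (`‖1‖ = √m`);
in print's operator currency (19) everything fits: `M_m(ℂ)` with the L²-operator norm is a normed ℂ-algebra with `‖1‖ = 1` (a C⋆-algebra), `U1` = the
contractions with contractive inverse (⊇ the unitary group), and FFFTO §2 IS `hflat` there at price `|m|` (its `‖toEuclideanCLM ·‖` is this norm by `rfl`).
THIS FILE makes that instantiation: ONE currency, no ruling needed, the price `|m|` explicit.

WHAT IS PROVED ([folklore]; `m` a nonempty Fintype; `‖·‖` on `Matrix m m ℂ` = the L²-operator norm (scoped); all other binders LFTI §2's VERBATIM at `𝔸 := Matrix m m ℂ`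
minus `{c} hflat`, plus `hd : 2 ≤ d`):
* §1 **`flat_letter_op`** — FFFTO §2 read in the scoped operator norm: for `Y : bonds → M_m(ℂ)` in the tree gauge,
  `(1∕(12d²)·(n^{d+1})⁻¹∕|m|)·Σ_c‖Y c‖² ≤ Σ_P‖Y(ι P 0) + Y(ι P 1) − Y(ι P 2) − Y(ι P 3)‖² + Σ_j‖(√(n^{d−2})·(n^{d+1})⁻¹) • Σ_{rt} Y(ιA j rt)‖²` — LFTI's `hflat` SHAPE.
* §2 **`ims_floor_full_form_op_of_local_gauges`** — LFTI §2 with `hflat := §1`: on `good`,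
  `((c_m∕2 − δ) − (1+t⁻¹)(ε_curl + ε_avg))∕(1+t)·Σ_c‖x c‖² ≤ Σ_P X_P(x)² + n^{d−2}·Σ_{(y,κ)}‖(Q₀(V₀)x̃)(n·y, κ)‖²`,
  `c_m = 1∕(12d²)·(n^{d+1})⁻¹∕|m|`, `δ = (2τ)²·4·2(d−1) + (2τ′(|ω|n))²·n^{d+1}·n`, `ω = √(n^{d−2})·n^{−(d+1)}`, `ε_curl`, `ε_avg` FFSQ's (route (B)).

NOT HERE (honest): the local gauges BY VALUE ((π4)∕R-V, LGTS; «`Mα₀` small», [B9] p. 428 — OWNER∕(A3)); `good`; `w`, `V₀` ((A3)); the restriction to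
`𝔲(m)`-valued fields (a real subspace — the floor restricts trivially; the (h1) side lives there); the HS-currency twin (needs CTL∕ATL without `NormOneClass` —
not typed); the coordinates bridge to `gamma0_assembly` at U ≠ 1 (AFC wants an inner-product norm: op → HS at one more price `|m|` by HSCL, ON A WORD);
`k > 1`; anything of Bałaban's beyond the cited PROVED letters.  BY-NAME EFFECT ON THE WALL: NONE (the wall is (R2); this is the (h2) half at k = 1, U ≠ 1,
one finite torus, one currency, modulo the local gauges).  NE7b NOT PRINTED ∕ NOT PROVED; spine PROVED 0∕9; rung (B)+1 on ONE finite T⁴ — NOT infinite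
volume, NOT the mass gap, NOT Clay.
HONEST DEPENDENCY: continuum YM on T⁴ ⇐ BetaPertH ∧ nine spine estimates (0/9 proved); BetaPertH ⇐ (D1) ∧ (D4) ∧ CAP+tail; G-an2-4 gates asym, D1 and NE2/3/4.
-/

set_option autoImplicit false

noncomputable section

open Finset
open scoped Matrix.Norms.L2Operator
open Literature.MathematicalPhysics.QuantumFieldTheory.Balaban1983to89.B14.TentUnityTorus (tentZ)
open Literature.MathematicalPhysics.QuantumFieldTheory.Balaban1983to89.B7Prop1Explicit (Site seg hol treeWord boxVec U1)
open Literature.MathematicalPhysics.QuantumFieldTheory.Balaban1983to89.B7Eq78Linearization (conjR conjR_add conjR_smul_real)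
open Literature.MathematicalPhysics.QuantumFieldTheory.Balaban1983to89.B7Prop3GeneralLinear (Q0cov)
open Literature.MathematicalPhysics.QuantumFieldTheory.Balaban1983to89.T4TermwiseTorus (tcls)
open Literature.MathematicalPhysics.QuantumFieldTheory.Balaban1983to89.B6BondElimination (treeBonds)
open Literature.MathematicalPhysics.QuantumFieldTheory.Balaban1983to89.B6Lemma24Torus (coarseSites)
open Summit.QuantumFields.BalabanUV.T4Continuum.NE7b.FlatFullFormFloorTorusOp (flat_full_form_floor_torus_op)
open Summit.QuantumFields.BalabanUV.T4Continuum.NE7b.LocalFloorTorusIMS (ims_floor_full_form_printed_weighted_sq_of_local_gauges)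

namespace Summit.QuantumFields.BalabanUV.T4Continuum.NE7b.LocalFloorTorusOp

variable {d : ℕ} {m : Type*} [Fintype m] [DecidableEq m] [Nonempty m]

/-! ## §1 The flat letter in the operator currency (FFFTO §2 read in the scoped norm) -/

/-- **THE FLAT LETTER `hflat` OF LFT ∕ LFTI IN PRINT's OPERATOR CURRENCY**: FFFTO §2 with `‖toEuclideanCLM ·‖ = ‖·‖` (`Matrix.cstar_norm_def`, `rfl`):
`(1∕(12d²)·(n^{d+1})⁻¹∕|m|)·Σ‖Y c‖² ≤ Σ_P‖curl Y‖² + Σ_j‖ω₀ • Σ_{rt} Y(ιA j rt)‖²` in the tree gauge, `ω₀ = √(n^{d−2})·(n^{d+1})⁻¹`. [folklore] -/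
theorem flat_letter_op (hd : 2 ≤ d) (n M : ℕ) [NeZero n] [NeZero M] [NeZero (n * M)]
    (ι : (Fin d → ZMod (n * M)) × {a : Fin d × Fin d // a.1 < a.2} → Fin 4 → (Fin d → ZMod (n * M)) × Fin d)
    (hι : ∀ x a, ι (x, a) = ![(x, a.1.1), (x + Pi.single a.1.1 1, a.1.2), (x + Pi.single a.1.2 1, a.1.1), (x, a.1.2)])
    (ιA : (Fin d → ZMod M) × Fin d → (Fin d → Fin n) × Fin n → (Fin d → ZMod (n * M)) × Fin d)
    (hιA : ∀ y κ r t, ιA (y, κ) (r, t) =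
      ((fun i => (((y i).val * n + (r i : ℕ) : ℕ) : ZMod (n * M))) + Pi.single κ ((t : ℕ) : ZMod (n * M)), κ)) :
    ∀ Y : (Fin d → ZMod (n * M)) × Fin d → Matrix m m ℂ,
      (∀ y ∈ coarseSites n (fun _ : Fin d => n * M), ∀ bd ∈ treeBonds n y, Y (tcls (n * M) bd.1, bd.2) = 0) →
      1 / (12 * (d : ℝ) ^ 2) * ((n : ℝ) ^ (d + 1))⁻¹ / Fintype.card m * ∑ c', ‖Y c'‖ ^ 2 ≤
        ∑ P, ‖Y (ι P 0) + Y (ι P 1) - Y (ι P 2) - Y (ι P 3)‖ ^ 2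
          + ∑ j, ‖(Real.sqrt ((n : ℝ) ^ (d - 2)) * ((n : ℝ) ^ (d + 1))⁻¹) • ∑ rt, Y (ιA j rt)‖ ^ 2 :=
  fun Y hY => flat_full_form_floor_torus_op (m := m) hd n M ι hι ιA hιA Y hY

/-! ## §2 The (h2) IMS floor at U ≠ 1 for `M_m(ℂ)`-valued fields, one currency -/

/-- **THE (h2) IMS FLOOR OF THE k = 1 FULL FORM AT U ≠ 1 FOR `M_m(ℂ)`-VALUED BOND FIELDS, OPERATOR CURRENCY** — LFTI
`ims_floor_full_form_printed_weighted_sq_of_local_gauges` at `𝔸 := Matrix m m ℂ` (L²-operator norm) with `hflat := flat_letter_op`: the flat constant is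
`c_m = 1∕(12d²)·(n^{d+1})⁻¹∕|m|`; displayed: the local gauges `g S` (`U1`-valued) with `τ`∕`τ′`-small gauged transports on the terms meeting each sine-tent
cube, `good ⊆` tree gauge, the transports `w` and the background `V₀` (`U1`). [folklore] -/
theorem ims_floor_full_form_op_of_local_gauges (hd : 2 ≤ d) (n M L Mp : ℕ) [NeZero n] [NeZero M] [NeZero (n * M)]
    [Fact (1 < n * M)] [NeZero Mp]
    (hL : 0 < L) (hMp : 2 ≤ Mp) (hN : n * M = Mp * L) (c₀ : ℕ)
    (ι : (Fin d → ZMod (n * M)) × {a : Fin d × Fin d // a.1 < a.2} → Fin 4 → (Fin d → ZMod (n * M)) × Fin d)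
    (hι : ∀ x a, ι (x, a) = ![(x, a.1.1), (x + Pi.single a.1.1 1, a.1.2), (x + Pi.single a.1.2 1, a.1.1), (x, a.1.2)])
    (w : (Fin d → ZMod (n * M)) × {a : Fin d × Fin d // a.1 < a.2} → Fin 3 → (Matrix m m ℂ)ˣ) (hw : ∀ P i, w P i ∈ U1 (Matrix m m ℂ))
    (R : (Fin d → ZMod (n * M)) × {a : Fin d × Fin d // a.1 < a.2} → (Fin d → ZMod (n * M)) × Fin d →
      Matrix m m ℂ →ₗ[ℝ] Matrix m m ℂ)
    (hR : ∀ P c, R P c =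
        if c = ι P 0 then LinearMap.id
        else if c = ι P 1 then LinearMap.mk ⟨conjR (w P 0), conjR_add (w P 0)⟩ (conjR_smul_real (w P 0))
        else if c = ι P 2 then -LinearMap.mk ⟨conjR (w P 1), conjR_add (w P 1)⟩ (conjR_smul_real (w P 1))
        else if c = ι P 3 then -LinearMap.mk ⟨conjR (w P 2), conjR_add (w P 2)⟩ (conjR_smul_real (w P 2))
        else 0)
    (X : (Fin d → ZMod (n * M)) × {a : Fin d × Fin d // a.1 < a.2} → ((Fin d → ZMod (n * M)) → Fin d → Matrix m m ℂ) → ℝ)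
    (hX : ∀ (y : Fin d → ZMod (n * M)) (a : {a : Fin d × Fin d // a.1 < a.2}) (B : (Fin d → ZMod (n * M)) → Fin d → Matrix m m ℂ),
      X (y, a) B = ‖B y a.1.1 + conjR (w (y, a) 0) (B (y + Pi.single a.1.1 1) a.1.2)
        - conjR (w (y, a) 1) (B (y + Pi.single a.1.2 1) a.1.1) - conjR (w (y, a) 2) (B y a.1.2)‖)
    (qb : (Fin d → ZMod M) → Site d) (hqb : ∀ y i, qb y i = (n : ℤ) * (((y i).val : ℕ) : ℤ))
    (ιA : (Fin d → ZMod M) × Fin d → (Fin d → Fin n) × Fin n → (Fin d → ZMod (n * M)) × Fin d)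
    (hιA : ∀ y κ r t, ιA (y, κ) (r, t) =
      ((fun i => (((y i).val * n + (r i : ℕ) : ℕ) : ZMod (n * M))) + Pi.single κ ((t : ℕ) : ZMod (n * M)), κ))
    (V₀ : Site d → Fin d → (Matrix m m ℂ)ˣ) (hV : ∀ x κ, V₀ x κ ∈ U1 (Matrix m m ℂ))
    (R' : (Fin d → ZMod M) × Fin d → (Fin d → ZMod (n * M)) × Fin d → Matrix m m ℂ →ₗ[ℝ] Matrix m m ℂ)
    (hR' : ∀ j c, R' j c = (Real.sqrt ((n : ℝ) ^ (d - 2)) * ((n : ℝ) ^ (d + 1))⁻¹) • ∑ rt ∈ Finset.univ.filter (fun rt => ιA j rt = c),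
        LinearMap.mk ⟨conjR (hol V₀ (qb j.1) (treeWord (boxVec n rt.1) ++ seg j.2 ((rt.2 : ℕ) : ℤ))),
          conjR_add (hol V₀ (qb j.1) (treeWord (boxVec n rt.1) ++ seg j.2 ((rt.2 : ℕ) : ℤ)))⟩
          (conjR_smul_real (hol V₀ (qb j.1) (treeWord (boxVec n rt.1) ++ seg j.2 ((rt.2 : ℕ) : ℤ)))))
    -- DISPLAYED: the local gauges and the smallness of the gauged transports on the terms meeting each cube
    (g : (Fin d → ZMod Mp) → (Fin d → ZMod (n * M)) → (Matrix m m ℂ)ˣ) (hg : ∀ S y, g S y ∈ U1 (Matrix m m ℂ))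
    (wg : (Fin d → ZMod Mp) → (Fin d → ZMod (n * M)) × {a : Fin d × Fin d // a.1 < a.2} → Fin 3 → (Matrix m m ℂ)ˣ)
    (hwg0 : ∀ S P, wg S P 0 = g S (ι P 0).1 * w P 0 * (g S (ι P 1).1)⁻¹)
    (hwg1 : ∀ S P, wg S P 1 = g S (ι P 0).1 * w P 1 * (g S (ι P 2).1)⁻¹)
    (hwg2 : ∀ S P, wg S P 2 = g S (ι P 0).1 * w P 2 * (g S (ι P 3).1)⁻¹)
    (base : (Fin d → ZMod M) × Fin d → (Fin d → ZMod (n * M)))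
    (wg' : (Fin d → ZMod Mp) → (Fin d → ZMod M) × Fin d → (Fin d → Fin n) × Fin n → (Matrix m m ℂ)ˣ)
    (hwg' : ∀ S j rt, wg' S j rt =
      g S (base j) * hol V₀ (qb j.1) (treeWord (boxVec n rt.1) ++ seg j.2 ((rt.2 : ℕ) : ℤ)) * (g S (ιA j rt).1)⁻¹)
    {τ τ' : ℝ} (hτ0 : 0 ≤ τ) (hτ0' : 0 ≤ τ')
    (hτ : ∀ S P, (∃ c' ∈ Finset.univ.image (ι P),
        (∏ ν, Real.sin (Real.pi / 2 * tentZ (L : ℝ) (c'.1 ν - (((S ν).val * L + c₀ : ℕ) : ZMod (n * M))))) ≠ 0) →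
      ∀ i, ‖(wg S P i : Matrix m m ℂ) - 1‖ ≤ τ)
    (hτ' : ∀ S j, (∃ c' ∈ Finset.univ.image (ιA j),
        (∏ ν, Real.sin (Real.pi / 2 * tentZ (L : ℝ) (c'.1 ν - (((S ν).val * L + c₀ : ℕ) : ZMod (n * M))))) ≠ 0) →
      ∀ rt, ‖(wg' S j rt : Matrix m m ℂ) - 1‖ ≤ τ')
    (good : ((Fin d → ZMod (n * M)) × Fin d → Matrix m m ℂ) → Prop)
    (hgood : ∀ x, good x → ∀ y ∈ coarseSites n (fun _ : Fin d => n * M), ∀ bd ∈ treeBonds n y, x (tcls (n * M) bd.1, bd.2) = 0)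
    {t : ℝ} (ht : 0 < t) (x : (Fin d → ZMod (n * M)) × Fin d → Matrix m m ℂ) (hx : good x) :
    (1 / (12 * (d : ℝ) ^ 2) * ((n : ℝ) ^ (d + 1))⁻¹ / Fintype.card m / 2
        - ((2 * τ) ^ 2 * (4 : ℕ) * (2 * (d - 1) : ℕ)
          + (2 * τ' * (|Real.sqrt ((n : ℝ) ^ (d - 2)) * ((n : ℝ) ^ (d + 1))⁻¹| * n)) ^ 2 * (n ^ (d + 1) : ℕ) * (n : ℕ))
        - (1 + t⁻¹) * ((1 : ℝ) ^ 2 * (Real.pi / (2 * L)) ^ 2 * (4 : ℕ) * (2 * (d - 1) : ℕ)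
          + (|Real.sqrt ((n : ℝ) ^ (d - 2)) * ((n : ℝ) ^ (d + 1))⁻¹| * n) ^ 2
            * (((d + 1) * (n - 1) : ℕ) * (Real.pi / (2 * L))) ^ 2 * (n ^ (d + 1) : ℕ) * (n : ℕ))) / (1 + t)
        * ∑ c', ‖x c'‖ ^ 2
      ≤ ∑ P, X P (fun y μ => x (y, μ)) ^ 2
        + (n : ℝ) ^ (d - 2) * ∑ j : (Fin d → ZMod M) × Fin d, ‖Q0cov n V₀ (fun z ν => x (tcls (n * M) z, ν)) (qb j.1) j.2‖ ^ 2 :=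
  ims_floor_full_form_printed_weighted_sq_of_local_gauges (𝔸 := Matrix m m ℂ) n M L Mp hL hMp hN c₀ ι hι w hw R hR X hX qb hqb ιA hιA
    V₀ hV R' hR' (flat_letter_op hd n M ι hι ιA hιA) g hg wg hwg0 hwg1 hwg2 base wg' hwg' hτ0 hτ0' hτ hτ' good hgood ht x hx

end Summit.QuantumFields.BalabanUV.T4Continuum.NE7b.LocalFloorTorusOp

end
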